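import Literature.AlgebraicGeometry.Modules.CechObjects
import Literature.AlgebraicGeometry.Modules.PushforwardAcyclicResolution
import Literature.AlgebraicGeometry.Modules.ExtCohomologyComparison
import Literature.AlgebraicGeometry.Modules.SectionsExact
import Literature.AlgebraicGeometry.Modules.IsoOfSectionsOnBasis
import Literature.AlgebraicGeometry.Modules.LocalExactness
import HarnessLib

/-!
# The Čech sheaves `Čⁿ(𝓤, M)` of a quasi-coherent module are `Γ`-acyclic when the faces of `𝓤` are
# affine (Hartshorne III.4.5, proof; The Stacks Project, Tags 01XD, 01EW)

Let `X` be a scheme, `𝓤 = (U_i)_{i ∈ ι}` a family of opens COVERING `X` all of whose faces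
`U_α = U_{α 0} ∩ ⋯ ∩ U_{α n}` (`Modules.face`) are AFFINE, and `M` an `𝒪_X`-module which is
affine-localizing (`Modules/AffineLocalizing`: e.g. quasi-coherent). Then for every `n` and every
`q` the Čech sheaf `Čⁿ(𝓤, M)` (`Modules/CechObjects`, `V ↦ Π_α Γ(M, V ∩ U_α)`, i.e.
`Π_α (j_α)_*(M|_{U_α})`) satisfies

  **`Ext^{q+1}_{𝒪_X}(𝒪_X, Čⁿ(𝓤, M)) = 0`**  (`Cech.subsingleton_ext_unit_obj_of_isAffineLocalizing`),

equivalently `H^{q+1}(X, Čⁿ(𝓤, M)) = 0` (`Cech.subsingleton_H_obj_of_isAffineLocalizing`). This is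
the acyclicity input of Leray's theorem "Čech cohomology of an affine cover computes the
cohomology of quasi-coherent modules" (Hartshorne III Thm. 4.5; The Stacks Project, Tag 01XD;
Görtz–Wedhorn II Thm. 22.9), which `Modules/CechComputesCohomology` deduces from it through the
exact Čech resolution (`Modules/CechResolution`) and `Algebra/Homology/ExtOfAcyclicResolution`. No
separatedness is assumed: only that all finite intersections of members of `𝓤` are affine.

Proof (dimension shifting on `M`, the opens fixed). Let `𝒜` be the class of `𝒪_X`-modules that are
acyclic on every affine open (`IsAcyclicOn` of `Modules/PushforwardAcyclicResolution`: by Serre's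
theorem `𝒜` contains the affine-localizing modules; it contains the injective modules and is stable
under cokernels of monomorphisms into injectives). For `N ∈ 𝒜` and `0 → N → I → Z → 0` with `I`
injective: (i) `0 → Čⁿ(N) → Čⁿ(I) → Čⁿ(Z) → 0` is short exact (`Cech.map_shortExact`: surjectivity
is tested on the basis of opens meeting every face in an affine open — the basic opens of the
`U_i` —, where `Γ(W ∩ U_α, I) → Γ(W ∩ U_α, Z)` is onto because `H¹(W ∩ U_α, N) = 0`);
(ii) `Čⁿ(I)` is flasque (`Cech.isFlasque_toSheaf_obj`), hence `Ext^{≥ 1}(𝒪_X, Čⁿ(I)) = 0`;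
(iii) `Γ(X, Čⁿ(I)) → Γ(X, Čⁿ(Z))` is onto (the faces themselves are affine), so
`Ext¹(𝒪_X, Čⁿ(N)) = 0`, and `Ext^{q+2}(𝒪_X, Čⁿ(N)) ≅ Ext^{q+1}(𝒪_X, Čⁿ(Z))` with `Z ∈ 𝒜` —
induction on `q` (`Cech.subsingleton_ext_unit_obj_succ`).

Everything is proved; no named facts. Mathlib searched (pin): no Čech-versus-derived-functor
comparison (`CategoryTheory/Sites/SheafCohomology` has `Sheaf.H` and the Čech complex functor only);
used: `Ext.covariant_sequence_exact₁`, `ShortComplex.ShortExact.comp_extClass`,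
`IsAffineOpen.exists_basicOpen_le`, `Scheme.basicOpen_res`, `TopCat.Presheaf.IsFlasque`.

## References

* R. Hartshorne, *Algebraic Geometry*, GTM 52 (1977), III Lemma 4.2, Prop. 4.3, Thm. 4.5 (p. 222).
  [Hartshorne1977]
* The Stacks Project, Tags 01XD (Cohomology of Schemes, Lemma 30.2.5), 01EW, 01XB. [StacksProject]
* U. Görtz, T. Wedhorn, *Algebraic Geometry II: Cohomology of Schemes* (2023), Thm. 22.9 (p. 332).
  [GortzWedhorn2023]
-/

noncomputable section

universe w u

open CategoryTheory CategoryTheory.Abelian CategoryTheory.Limits Opposite TopologicalSpace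
  AlgebraicGeometry
open Literature.AlgebraicGeometry.HodgeTheory Literature.AlgebraicGeometry.Motives

namespace Literature.AlgebraicGeometry.Modules

variable {X : Scheme.{u}} {ι : Type u} (U : ι → X.Opens)

/-! ### Faces of extended simplices; the basis of opens meeting the faces affinely -/

/-- `U_{(i, α)} = U_i ∩ U_α` (intersections of members of the cover along an extended simplex).
[cite: Hartshorne1977, III.4 p. 218 (notation `U_{i₀…i_p}`)] -/
lemma face_cons {n : ℕ} (i : ι) (α : Fin (n + 1) → ι) :
    face U (Fin.cons i α : Fin (n + 2) → ι) = U i ⊓ face U α := by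
  apply le_antisymm
  · refine le_inf ?_ (le_iInf fun k => ?_)
    · exact (face_le U (Fin.cons i α : Fin (n + 2) → ι) 0).trans (by rw [Fin.cons_zero])
    · exact (face_le U (Fin.cons i α : Fin (n + 2) → ι) k.succ).trans (by rw [Fin.cons_succ])
  · refine le_iInf fun k => Fin.cases ?_ (fun j => ?_) k
    · rw [Fin.cons_zero]; exact inf_le_left
    · rw [Fin.cons_succ]; exact inf_le_right.trans (face_le U α j)

/-- A `0`-simplex face is the open itself: `U_{(i)} = U_i`. [cite: Hartshorne1977, III.4 p. 218 (notation `U_{i₀…i_p}`)] -/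
lemma face_const_zero (i : ι) : face U (fun _ : Fin 1 => i) = U i :=
  le_antisymm (face_le U (fun _ : Fin 1 => i) 0)
    (show U ((fun _ : Fin 1 => i) 0) ≤ _ from le_face_zero U fun _ : Fin 1 => i)

variable {U} in
/-- If all faces of `𝓤` are affine then so is `U_i ∩ U_α`. [cite: Hartshorne1977, III Thm. 4.5 (hypothesis)] -/
lemma isAffineOpen_inf_face (hU : ∀ {m : ℕ} (β : Fin (m + 1) → ι), IsAffineOpen (face U β))
    {n : ℕ} (i : ι) (α : Fin (n + 1) → ι) : IsAffineOpen (U i ⊓ face U α) := by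
  rw [← face_cons]; exact hU _

variable {U} in
/-- **The opens meeting every face of `𝓤` in an affine open form a basis** when the faces of `𝓤`
are affine and `𝓤` covers `X`: the basic opens `D(f) ⊆ U_i` qualify, since
`D(f) ∩ U_α = D(f|_{U_i ∩ U_α})` is a basic open of the affine `U_i ∩ U_α`.
[cite: StacksProject, Tag 01XD (proof)] -/
lemma isBasis_inf_face_affine (hU : ∀ {m : ℕ} (β : Fin (m + 1) → ι), IsAffineOpen (face U β))
    (hcov : ⨆ i, U i = ⊤) :
    Opens.IsBasis {W : X.Opens | ∀ (n : ℕ) (α : Fin (n + 1) → ι), IsAffineOpen (W ⊓ face U α)} := by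
  rw [Opens.isBasis_iff_nbhd]
  intro V x hx
  have hxU : x ∈ (⨆ i, U i : X.Opens) := by rw [hcov]; trivial
  obtain ⟨i, hi⟩ := Opens.mem_iSup.mp hxU
  have hUi : IsAffineOpen (U i) := by rw [← face_const_zero U i]; exact hU _
  obtain ⟨f, hfV, hxf⟩ := hUi.exists_basicOpen_le ⟨x, hx⟩ hi
  refine ⟨X.basicOpen f, fun n α => ?_, hxf, hfV⟩
  have hle : U i ⊓ face U α ≤ U i := inf_le_left
  have e : X.basicOpen f ⊓ face U α = X.basicOpen (X.presheaf.map (homOfLE hle).op f) := by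
    rw [Scheme.basicOpen_res, inf_assoc, inf_comm (face U α) (X.basicOpen f), ← inf_assoc,
      inf_eq_right.mpr (X.basicOpen_le f)]
  rw [e]
  exact (isAffineOpen_inf_face hU i α).basicOpen _

namespace Cech

variable (n : ℕ)

/-! ### `Čⁿ(𝓤, –)` on a short complex -/

/-- `Čⁿ(𝓤, 0) = 0` (`Čⁿ(𝓤, –)` is an additive functor). [cite: Hartshorne1977, III Lemma 4.2 and III.4 p. 220 (functoriality of `𝒞•(𝔘, ℱ)`)] -/
theorem map_zero_hom (M N : X.Modules) : map U n M (0 : M ⟶ N) = 0 :=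
  hom_ext_to fun V s α => by
    rw [map_app_apply, Scheme.Modules.Hom.zero_app, Scheme.Modules.Hom.zero_app]
    rfl

/-- `Čⁿ(𝓤, f) ≫ Čⁿ(𝓤, g) = 0` for a short complex `f, g` (functoriality of `Čⁿ(𝓤, –)`).
[cite: Hartshorne1977, III.4 p. 220 (functoriality of `𝒞•(𝔘, ℱ)`)] -/
theorem map_comp_eq_zero (S : ShortComplex X.Modules) : map U n _ S.f ≫ map U n _ S.g = 0 := by
  rw [← map_comp, S.zero, map_zero_hom]

/-! ### `Čⁿ(𝓤, I)` is flasque for `I` flasque -/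

/-- **`Čⁿ(𝓤, I)` is flasque when `I` is**: the restriction `Π_α Γ(I, V ∩ U_α) → Π_α Γ(I, W ∩ U_α)`
is componentwise restriction of `I`, hence surjective. [cite: Hartshorne1977, III Prop. 4.3 (proof)] -/
theorem isFlasque_toSheaf_obj (I : X.Modules)
    [hI : TopCat.Sheaf.IsFlasque ((modulesToSheaf X).obj I)] :
    TopCat.Sheaf.IsFlasque ((modulesToSheaf X).obj (obj U n I)) where
  epi {V W} i := by
    rw [AddCommGrpCat.epi_iff_surjective]
    intro s
    have hs : ∀ α : Fin (n + 1) → ι, ∃ t : Γ(I, V.unop ⊓ face U α),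
        res I (inf_le_inf_right (face U α) i.unop.le) t = (s : Sections U n I W.unop) α := fun α => by
      have h := hI.epi (homOfLE (inf_le_inf_right (face U α) i.unop.le)).op
      rw [AddCommGrpCat.epi_iff_surjective] at h
      exact h _
    choose t ht using hs
    refine ⟨(t : Sections U n I V.unop), funext fun α => ?_⟩
    change (((obj U n I).presheaf.map i) t : Sections U n I W.unop) α = _
    rw [show i = i.unop.op from rfl, obj_map_apply]
    exact ht α

/-- Hence `Ext^{q+1}_{𝒪_X}(𝒪_X, Čⁿ(𝓤, I)) = 0` for `I` injective (injective modules are flasque,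
flasque sheaves have no higher cohomology, Hartshorne III.2.4–2.5 and III.6.3 (c)).
[cite: Hartshorne1977, III Prop. 2.5 and Prop. 6.3 (c)] -/
theorem subsingleton_ext_unit_obj_of_injective [HasExt.{w} X.Modules] (I : X.Modules) [Injective I]
    (q : ℕ) : Subsingleton (Ext.{w} (unitModule X) (obj U n I) (q + 1)) := by
  haveI : TopCat.Sheaf.IsFlasque ((modulesToSheaf X).obj I) := isFlasque_of_injective_modules I
  haveI := isFlasque_toSheaf_obj U n I
  haveI : Subsingleton (((modulesToSheaf X).obj (obj U n I)).H (q + 1)) :=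
    subsingleton_H_of_isFlasque _ _ (Nat.succ_pos q)
  exact subsingleton_ext_unit_of_subsingleton_H _ _

/-! ### `Čⁿ(𝓤, –)` on a short exact sequence with acyclic kernel -/

section ShortExact

variable {n} {S : ShortComplex X.Modules} (hS : S.ShortExact)
include hS

/-- `Čⁿ(𝓤, f)` is injective on sections for `f` a monomorphism (componentwise left exactness of
sections). [cite: Hartshorne1977, II Ex. 1.8] -/
theorem map_app_injective (V : X.Opens) : Function.Injective ((map U n _ S.f).app V) := by
  intro s s' h
  refine funext fun α => (sections_exact_of_shortExact hS (V ⊓ face U α)).1 ?_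
  have h' := congrArg (fun x : Γ(obj U n S.X₂, V) => (x : Sections U n S.X₂ V) α) h
  simpa only [map_app_apply] using h'

/-- `Čⁿ(𝓤, S)` is exact at the middle, even sectionwise: a cochain of `S.X₂` killed by `g` comes
from `S.X₁` componentwise. [cite: Hartshorne1977, II Ex. 1.8] -/
theorem map_exact : (ShortComplex.mk (map U n _ S.f) (map U n _ S.g) (map_comp_eq_zero U n S)).Exact := by
  refine exact_of_locally_exact _ fun V s hs x hx => ⟨V, 𝟙 V, hx, ?_⟩
  have hs' : ∀ α, S.g.app (V ⊓ face U α) ((s : Sections U n S.X₂ V) α) = 0 := fun α => by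
    have h := congrArg (fun x : Γ(obj U n S.X₃, V) => (x : Sections U n S.X₃ V) α) hs
    change ((map U n _ S.g).app V s : Sections U n S.X₃ V) α = (0 : Sections U n S.X₃ V) α at h
    rw [map_app_apply] at h
    exact h
  choose t ht using fun α => (sections_exact_of_shortExact hS (V ⊓ face U α)).2 _ (hs' α)
  refine ⟨(t : Sections U n S.X₁ V), ?_⟩
  have e : (ShortComplex.mk (map U n _ S.f) (map U n _ S.g) (map_comp_eq_zero U n S)).X₂.presheaf.map (𝟙 V).op s = s := by
    rw [op_id, CategoryTheory.Functor.map_id]; rfl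
  rw [e]
  change ((map U n _ S.f).app V (t : Sections U n S.X₁ V) : Sections U n S.X₂ V) =
    (s : Sections U n S.X₂ V)
  exact funext fun α => by rw [map_app_apply]; exact ht α

/-- **`Čⁿ(𝓤, g)` is an epimorphism when `S.X₁` is acyclic on all affine opens**, the faces of `𝓤`
being affine and `𝓤` a cover: on an open `W` meeting every face in an affine open,
`Γ(W ∩ U_α, X₂) → Γ(W ∩ U_α, X₃)` is onto since `H¹(W ∩ U_α, X₁) = 0`, and such `W` form a basis.
[cite: StacksProject, Tag 01XD (proof)] [cite: Hartshorne1977, III Thm. 4.5 (proof)] -/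
theorem epi_map (hU : ∀ {m : ℕ} (β : Fin (m + 1) → ι), IsAffineOpen (face U β))
    (hcov : ⨆ i, U i = ⊤) (h₁ : ∀ W : X.Opens, IsAffineOpen W → IsAcyclicOn S.X₁ W) :
    Epi (map U n _ S.g) := by
  refine epi_of_surjective_on_basis _ (isBasis_inf_face_affine hU hcov) fun W hW s => ?_
  have hsurj : ∀ α : Fin (n + 1) → ι, Function.Surjective (S.g.app (W ⊓ face U α)) := fun α =>
    IsAcyclicOn.surjective_app_of_shortExact hS (W ⊓ face U α) (h₁ _ (hW n α))
  choose t ht using fun α => hsurj α ((s : Sections U n S.X₃ W) α)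
  exact ⟨(t : Sections U n S.X₂ W), funext fun α => by rw [map_app_apply]; exact ht α⟩

/-- **`0 → Čⁿ(𝓤, X₁) → Čⁿ(𝓤, X₂) → Čⁿ(𝓤, X₃) → 0` is short exact** for a short exact
`0 → X₁ → X₂ → X₃ → 0` with `X₁` acyclic on affine opens (faces of `𝓤` affine, `𝓤` a cover).
[cite: Hartshorne1977, III Thm. 4.5 (proof)] [cite: StacksProject, Tag 01XD] -/
theorem map_shortExact (hU : ∀ {m : ℕ} (β : Fin (m + 1) → ι), IsAffineOpen (face U β))
    (hcov : ⨆ i, U i = ⊤) (h₁ : ∀ W : X.Opens, IsAffineOpen W → IsAcyclicOn S.X₁ W) :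
    (ShortComplex.mk (map U n _ S.f) (map U n _ S.g) (map_comp_eq_zero U n S)).ShortExact where
  exact := map_exact U hS
  mono_f := mono_of_injective_app_of_isAffineOpen _ fun V _ => map_app_injective U hS V
  epi_g := epi_map U hS hU hcov h₁

end ShortExact

/-! ### Global sections of `Čⁿ(𝓤, g)` are onto; the induction -/

/-- **`Hom(𝒪_X, Čⁿ(𝓤, X₂)) → Hom(𝒪_X, Čⁿ(𝓤, X₃))` is onto** for a short exact `S` with `X₁`
acyclic on the (affine) faces: `Hom(𝒪_X, Čⁿ(𝓤, G)) = Γ(X, Čⁿ(𝓤, G)) = Π_α Γ(U_α, G)` and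
`Γ(U_α, X₂) → Γ(U_α, X₃)` is onto (`H¹(U_α, X₁) = 0`). [cite: Hartshorne1977, III Thm. 4.5 (proof)] -/
theorem comp_map_surjective {S : ShortComplex X.Modules} (hS : S.ShortExact)
    (hU : ∀ {m : ℕ} (β : Fin (m + 1) → ι), IsAffineOpen (face U β))
    (h₁ : ∀ W : X.Opens, IsAffineOpen W → IsAcyclicOn S.X₁ W) :
    Function.Surjective (fun ψ : unitModule X ⟶ obj U n S.X₂ => ψ ≫ map U n _ S.g) := by
  intro φ
  let s : Sections U n S.X₃ ⊤ := φ.app ⊤ (1 : X.presheaf.obj (op ⊤))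
  have hsurj : ∀ α : Fin (n + 1) → ι, Function.Surjective (S.g.app (⊤ ⊓ face U α)) := fun α =>
    IsAcyclicOn.surjective_app_of_shortExact hS _ (h₁ _ (by rw [top_inf_eq]; exact hU α))
  choose t ht using fun α => hsurj α (s α)
  obtain ⟨ψ, hψ⟩ := app_top_one_surjective (obj U n S.X₂) (t : Sections U n S.X₂ ⊤)
  refine ⟨ψ, app_top_one_injective (obj U n S.X₃) ?_⟩
  change (ψ ≫ map U n _ S.g).app ⊤ (1 : X.presheaf.obj (op ⊤)) = φ.app ⊤ (1 : X.presheaf.obj (op ⊤))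
  rw [Scheme.Modules.Hom.comp_app, CategoryTheory.comp_apply]
  have hψ' : (ψ.app ⊤ (1 : X.presheaf.obj (op ⊤)) : Sections U n S.X₂ ⊤) = t := hψ
  change ((map U n _ S.g).app ⊤ (ψ.app ⊤ (1 : X.presheaf.obj (op ⊤))) : Sections U n S.X₃ ⊤) = s
  refine funext fun α => ?_
  rw [map_app_apply, hψ']
  exact ht α

/-- **`Ext^{q+1}_{𝒪_X}(𝒪_X, Čⁿ(𝓤, N)) = 0` for every `N` acyclic on all affine opens**, when the
faces of `𝓤` are affine and `𝓤` covers `X` — by dimension shifting along `0 → N → I → Z → 0`, `I`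
injective: `Čⁿ` of it is short exact, `Čⁿ(𝓤, I)` is flasque, `Γ(X, Čⁿ(I)) → Γ(X, Čⁿ(Z))` is onto,
and `Z` is again acyclic on affine opens. [cite: Hartshorne1977, III Thm. 4.5 (proof)]
[cite: StacksProject, Tag 01XD] -/
theorem subsingleton_ext_unit_obj_succ [HasExt.{w} X.Modules]
    (hU : ∀ {m : ℕ} (β : Fin (m + 1) → ι), IsAffineOpen (face U β)) (hcov : ⨆ i, U i = ⊤)
    (q : ℕ) {N : X.Modules} (hN : ∀ W : X.Opens, IsAffineOpen W → IsAcyclicOn N W) :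
    Subsingleton (Ext.{w} (unitModule X) (obj U n N) (q + 1)) := by
  induction q generalizing N with
  | zero =>
    let S : ShortComplex X.Modules :=
      ShortComplex.mk (Injective.ι N) (cokernel.π (Injective.ι N)) (cokernel.condition _)
    have hS : S.ShortExact := { exact := ShortComplex.exact_cokernel _ }
    have hT := map_shortExact U (n := n) hS hU hcov hN
    haveI : Subsingleton (Ext.{w} (unitModule X) (ShortComplex.mk (map U n _ S.f) (map U n _ S.g) (map_comp_eq_zero U n S)).X₂ 1) :=
      subsingleton_ext_unit_obj_of_injective U n (Injective.under N) 0
    refine subsingleton_of_forall_eq 0 fun y => ?_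
    obtain ⟨x, rfl⟩ := Ext.covariant_sequence_exact₁ (X := unitModule X) (hS := hT) y
      (Subsingleton.elim _ _) (zero_add 1)
    obtain ⟨ψ, hψ⟩ : ∃ ψ : unitModule X ⟶ (ShortComplex.mk (map U n _ S.f) (map U n _ S.g) (map_comp_eq_zero U n S)).X₂,
        ψ ≫ (ShortComplex.mk (map U n _ S.f) (map U n _ S.g) (map_comp_eq_zero U n S)).g = Ext.homEquiv₀ x :=
      comp_map_surjective U n hS hU hN (Ext.homEquiv₀ x)
    have hx : x = (Ext.mk₀ ψ).comp (Ext.mk₀ (ShortComplex.mk (map U n _ S.f) (map U n _ S.g) (map_comp_eq_zero U n S)).g) (add_zero 0) := by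
      rw [Ext.mk₀_comp_mk₀, hψ, Ext.mk₀_homEquiv₀_apply]
    rw [hx, Ext.comp_assoc_of_second_deg_zero, hT.comp_extClass, Ext.comp_zero]
  | succ q ih =>
    let S : ShortComplex X.Modules :=
      ShortComplex.mk (Injective.ι N) (cokernel.π (Injective.ι N)) (cokernel.condition _)
    have hS : S.ShortExact := { exact := ShortComplex.exact_cokernel _ }
    have hT := map_shortExact U (n := n) hS hU hcov hN
    have hZ : ∀ W : X.Opens, IsAffineOpen W → IsAcyclicOn S.X₃ W := fun W hW =>
      IsAcyclicOn.of_shortExact₃ hS W (hN W hW) (IsAcyclicOn.of_injective _ W)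
    haveI : Subsingleton (Ext.{w} (unitModule X) (ShortComplex.mk (map U n _ S.f) (map U n _ S.g) (map_comp_eq_zero U n S)).X₃ (q + 1)) := ih hZ
    haveI : Subsingleton (Ext.{w} (unitModule X) (ShortComplex.mk (map U n _ S.f) (map U n _ S.g) (map_comp_eq_zero U n S)).X₂ (q + 1 + 1)) :=
      subsingleton_ext_unit_obj_of_injective U n (Injective.under N) (q + 1)
    exact Ext.subsingleton_X₁ (unitModule X) hT (q + 1)

/-- **`Ext^{q+1}_{𝒪_X}(𝒪_X, Čⁿ(𝓤, M)) = 0` for `M` affine-localizing (e.g. quasi-coherent)**, the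
faces of the cover `𝓤` being affine (Serre: `M` is acyclic on every affine open).
[cite: Hartshorne1977, III Thm. 4.5 (proof)] [cite: StacksProject, Tags 01XD and 01XB] -/
theorem subsingleton_ext_unit_obj_of_isAffineLocalizing [HasExt.{w} X.Modules]
    (hU : ∀ {m : ℕ} (β : Fin (m + 1) → ι), IsAffineOpen (face U β)) (hcov : ⨆ i, U i = ⊤)
    {M : X.Modules} (hM : IsAffineLocalizing M) (q : ℕ) :
    Subsingleton (Ext.{w} (unitModule X) (obj U n M) (q + 1)) :=
  subsingleton_ext_unit_obj_succ U n hU hcov q fun _ hW => IsAcyclicOn.of_isAffineLocalizing hM hW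

/-- **`H^{q+1}(X, Čⁿ(𝓤, M)) = 0`** (Mathlib's `Sheaf.H` of the underlying abelian sheaf) for `M`
affine-localizing and a cover `𝓤` with affine faces (through `Extⁱ(𝒪_X, –) ≅ Hⁱ(X, –)`,
Hartshorne III.6.3 (c)). [cite: Hartshorne1977, III Thm. 4.5 (proof) and Prop. 6.3 (c)] -/
theorem subsingleton_H_obj_of_isAffineLocalizing
    (hU : ∀ {m : ℕ} (β : Fin (m + 1) → ι), IsAffineOpen (face U β)) (hcov : ⨆ i, U i = ⊤)
    {M : X.Modules} (hM : IsAffineLocalizing M) (q : ℕ) :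
    Subsingleton (((modulesToSheaf X).obj (obj U n M)).H (q + 1)) :=
  haveI := subsingleton_ext_unit_obj_of_isAffineLocalizing.{u + 1} U n hU hcov hM q
  (extUnitAddEquivCohomology.{u + 1} (obj U n M) (q + 1)).symm.toEquiv.subsingleton

/-! ### Variant: the basis of test opens as a hypothesis (families that need not cover `X`)

For the ORDERED Čech complex (`Modules/CechOrderedComplex`) the Čech sheaves are `Cech.obj W 0 M` for
the family `W` of `n`-dimensional faces of a cover, which does NOT itself cover `X`; what survives is
the basis of opens meeting every face of `W` in an affine open (the basic opens of the members of the
original cover). The dimension shifting above only uses that basis. -/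

section OfIsBasis

variable {n} {S : ShortComplex X.Modules} (hS : S.ShortExact)
include hS

/-- `Čⁿ(𝓤, g)` is an epimorphism when `S.X₁` is acyclic on all affine opens, GIVEN a basis of opens
meeting every face of `𝓤` in an affine open. [cite: StacksProject, Tag 01XD (proof)]
[cite: Hartshorne1977, III Thm. 4.5 (proof)] -/
theorem epi_map_of_isBasis
    (hB : Opens.IsBasis {W : X.Opens | ∀ (n : ℕ) (α : Fin (n + 1) → ι), IsAffineOpen (W ⊓ face U α)})
    (h₁ : ∀ W : X.Opens, IsAffineOpen W → IsAcyclicOn S.X₁ W) :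
    Epi (map U n _ S.g) := by
  refine epi_of_surjective_on_basis _ hB fun W hW s => ?_
  have hsurj : ∀ α : Fin (n + 1) → ι, Function.Surjective (S.g.app (W ⊓ face U α)) := fun α =>
    IsAcyclicOn.surjective_app_of_shortExact hS (W ⊓ face U α) (h₁ _ (hW n α))
  choose t ht using fun α => hsurj α ((s : Sections U n S.X₃ W) α)
  exact ⟨(t : Sections U n S.X₂ W), funext fun α => by rw [map_app_apply]; exact ht α⟩

/-- `0 → Čⁿ(𝓤, X₁) → Čⁿ(𝓤, X₂) → Čⁿ(𝓤, X₃) → 0` is short exact for `S` short exact with `X₁` acyclic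
on affine opens, GIVEN a basis of opens meeting every face of `𝓤` in an affine open.
[cite: Hartshorne1977, III Thm. 4.5 (proof)] [cite: StacksProject, Tag 01XD] -/
theorem map_shortExact_of_isBasis
    (hB : Opens.IsBasis {W : X.Opens | ∀ (n : ℕ) (α : Fin (n + 1) → ι), IsAffineOpen (W ⊓ face U α)})
    (h₁ : ∀ W : X.Opens, IsAffineOpen W → IsAcyclicOn S.X₁ W) :
    (ShortComplex.mk (map U n _ S.f) (map U n _ S.g) (map_comp_eq_zero U n S)).ShortExact where
  exact := map_exact U hS
  mono_f := mono_of_injective_app_of_isAffineOpen _ fun V _ => map_app_injective U hS V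
  epi_g := epi_map_of_isBasis U hS hB h₁

end OfIsBasis

/-- **`Ext^{q+1}_{𝒪_X}(𝒪_X, Čⁿ(𝓤, N)) = 0` for `N` acyclic on affine opens**, for a family `𝓤` with
AFFINE FACES and a BASIS of opens meeting every face in an affine open (no covering hypothesis on
`𝓤` — e.g. `𝓤` the family of `n`-faces of an affine-faced cover). Same dimension shifting as
`subsingleton_ext_unit_obj_succ`. [cite: Hartshorne1977, III Thm. 4.5 (proof)] [cite: StacksProject, Tag 01XD] -/
theorem subsingleton_ext_unit_obj_succ_of_isBasis [HasExt.{w} X.Modules]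
    (hU : ∀ {m : ℕ} (β : Fin (m + 1) → ι), IsAffineOpen (face U β))
    (hB : Opens.IsBasis {W : X.Opens | ∀ (n : ℕ) (α : Fin (n + 1) → ι), IsAffineOpen (W ⊓ face U α)})
    (q : ℕ) {N : X.Modules} (hN : ∀ W : X.Opens, IsAffineOpen W → IsAcyclicOn N W) :
    Subsingleton (Ext.{w} (unitModule X) (obj U n N) (q + 1)) := by
  induction q generalizing N with
  | zero =>
    let S : ShortComplex X.Modules :=
      ShortComplex.mk (Injective.ι N) (cokernel.π (Injective.ι N)) (cokernel.condition _)
    have hS : S.ShortExact := { exact := ShortComplex.exact_cokernel _ }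
    have hT := map_shortExact_of_isBasis U (n := n) hS hB hN
    haveI : Subsingleton (Ext.{w} (unitModule X)
        (ShortComplex.mk (map U n _ S.f) (map U n _ S.g) (map_comp_eq_zero U n S)).X₂ 1) :=
      subsingleton_ext_unit_obj_of_injective U n (Injective.under N) 0
    refine subsingleton_of_forall_eq 0 fun y => ?_
    obtain ⟨x, rfl⟩ := Ext.covariant_sequence_exact₁ (X := unitModule X) (hS := hT) y
      (Subsingleton.elim _ _) (zero_add 1)
    obtain ⟨ψ, hψ⟩ : ∃ ψ : unitModule X ⟶
        (ShortComplex.mk (map U n _ S.f) (map U n _ S.g) (map_comp_eq_zero U n S)).X₂,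
        ψ ≫ (ShortComplex.mk (map U n _ S.f) (map U n _ S.g) (map_comp_eq_zero U n S)).g =
          Ext.homEquiv₀ x :=
      comp_map_surjective U n hS hU hN (Ext.homEquiv₀ x)
    have hx : x = (Ext.mk₀ ψ).comp
        (Ext.mk₀ (ShortComplex.mk (map U n _ S.f) (map U n _ S.g) (map_comp_eq_zero U n S)).g)
        (add_zero 0) := by
      rw [Ext.mk₀_comp_mk₀, hψ, Ext.mk₀_homEquiv₀_apply]
    rw [hx, Ext.comp_assoc_of_second_deg_zero, hT.comp_extClass, Ext.comp_zero]
  | succ q ih =>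
    let S : ShortComplex X.Modules :=
      ShortComplex.mk (Injective.ι N) (cokernel.π (Injective.ι N)) (cokernel.condition _)
    have hS : S.ShortExact := { exact := ShortComplex.exact_cokernel _ }
    have hT := map_shortExact_of_isBasis U (n := n) hS hB hN
    have hZ : ∀ W : X.Opens, IsAffineOpen W → IsAcyclicOn S.X₃ W := fun W hW =>
      IsAcyclicOn.of_shortExact₃ hS W (hN W hW) (IsAcyclicOn.of_injective _ W)
    haveI : Subsingleton (Ext.{w} (unitModule X)
        (ShortComplex.mk (map U n _ S.f) (map U n _ S.g) (map_comp_eq_zero U n S)).X₃ (q + 1)) := ih hZ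
    haveI : Subsingleton (Ext.{w} (unitModule X)
        (ShortComplex.mk (map U n _ S.f) (map U n _ S.g) (map_comp_eq_zero U n S)).X₂ (q + 1 + 1)) :=
      subsingleton_ext_unit_obj_of_injective U n (Injective.under N) (q + 1)
    exact Ext.subsingleton_X₁ (unitModule X) hT (q + 1)

/-- **`Ext^{q+1}_{𝒪_X}(𝒪_X, Čⁿ(𝓤, M)) = 0` for `M` affine-localizing**, for an affine-faced family
`𝓤` and a basis of opens meeting every face in an affine open. [cite: Hartshorne1977, III Thm. 4.5 (proof)]
[cite: StacksProject, Tags 01XD and 01XB] -/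
theorem subsingleton_ext_unit_obj_of_isAffineLocalizing_of_isBasis [HasExt.{w} X.Modules]
    (hU : ∀ {m : ℕ} (β : Fin (m + 1) → ι), IsAffineOpen (face U β))
    (hB : Opens.IsBasis {W : X.Opens | ∀ (n : ℕ) (α : Fin (n + 1) → ι), IsAffineOpen (W ⊓ face U α)})
    {M : X.Modules} (hM : IsAffineLocalizing M) (q : ℕ) :
    Subsingleton (Ext.{w} (unitModule X) (obj U n M) (q + 1)) :=
  subsingleton_ext_unit_obj_succ_of_isBasis U n hU hB q fun _ hW =>
    IsAcyclicOn.of_isAffineLocalizing hM hW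

end Cech

end Literature.AlgebraicGeometry.Modules

end
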